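import Summits.Ventures.HodgeRepro.Night3GSetFormGram
import Summits.Ventures.HodgeRepro.Night3GSetWeilModel

/-!
# The concrete form is non-degenerate on the Weil space

Blind re-derivation cell `pub-hodge-repro`, seat `night-3` (gen 5, row 5; NIGHT3.md §11.8).  Imports this gen's
`Night3GSetFormGram` (the monomial Gram matrix of the concrete form) and gen 4's `Night3GSetWeilModel` (the concrete
Weil space `weilSpace M = span {line |M| σ}`).  Namespace `HodgeRepro.Night3.GSetModel`.

**`eq_zero_of_mem_weilSpace_of_forall_Qc_line_eq_zero`**: for `n ≥ 1` an element `x = ∑_σ c_σ ℓ_σ` of the Weil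
space with `Qc(x, ℓ_τ) = 0` for every `τ` is `0` — pairing with `ℓ_{cσ}` isolates `c_σ · Qc(ℓ_σ, ℓ_{cσ})` (the
monomial Gram matrix), and `Qc(ℓ_σ, ℓ_{cσ}) ≠ 0`.  So the restriction of the route's form `Q′ = ∫ x ∪ y ∪ Λ` to
the Weil space is non-degenerate: the shape LEMMA-L-P-v2.md step (2) uses to project.  Nothing here closes S4;
nothing here says anything about the status of the Hodge conjecture for CM abelian varieties, which is NOT proved.
-/

set_option autoImplicit false
open Finset Module
open scoped Pointwise
namespace HodgeRepro.Night3.GSetModel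

variable {G : Type*} [Group G] [Fintype G] [DecidableEq G] [LinearOrder G]

/-- `Qc(∑_σ c_σ ℓ_σ, ℓ_{cσ'}) = c_{σ'} · Qc(ℓ_{σ'}, ℓ_{cσ'})`: the monomial Gram matrix isolates one coefficient. -/
theorem Qc_sum_line_line_conj {c : G} (hc : IsComplexConj c) {Φ₀ : Finset G} (hΦ : IsCMType c Φ₀) {n : ℕ}
    (a : Fin n → G → ℂ) (hn : 0 < n) (coef : G → ℂ) (σ' : G) :
    Qc hc hΦ a (∑ σ, coef σ • line n σ) (line n (c * σ')) =
      coef σ' * Qc hc hΦ a (line n σ') (line n (c * σ')) := by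
  rw [map_sum, LinearMap.sum_apply, Finset.sum_eq_single σ']
  · rw [map_smul, LinearMap.smul_apply, smul_eq_mul]
  · intro σ _ hσ
    rw [map_smul, LinearMap.smul_apply,
      Qc_line_line_eq_zero_of_ne hc hΦ a hn (σ := σ) (τ := c * σ') (fun h => hσ (mul_left_cancel h).symm), smul_zero]
  · intro h
    exact absurd (mem_univ _) h

/-- **The concrete form is non-degenerate on the span of the lines**: an element of the Weil space pairing to `0`
with every line is `0` (`n ≥ 1`, non-vanishing coefficients). -/
theorem eq_zero_of_mem_span_line_of_forall_Qc_line_eq_zero {c : G} (hc : IsComplexConj c) {Φ₀ : Finset G}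
    (hΦ : IsCMType c Φ₀) {n : ℕ} (a : Fin n → G → ℂ) (ha : ∀ i ρ, ρ ∈ Φ₀ → a i ρ ≠ 0) (hn : 0 < n)
    {x : Hn G n} (hx : x ∈ Submodule.span ℂ (Set.range (line (G := G) n)))
    (h : ∀ τ, Qc hc hΦ a x (line n τ) = 0) : x = 0 := by
  obtain ⟨coef, rfl⟩ := (Submodule.mem_span_range_iff_exists_fun ℂ).mp hx
  refine Finset.sum_eq_zero fun σ _ => ?_
  have h1 := h (c * σ)
  rw [Qc_sum_line_line_conj hc hΦ a hn coef σ] at h1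
  rw [(mul_eq_zero.mp h1).resolve_right (Qc_line_line_conj_ne_zero hc hΦ a ha σ), zero_smul]

/-- **The concrete form is non-degenerate on the concrete Weil space** `weilSpace M` of a non-empty corner
product: `x ∈ W_F(B_M)` with `Q(x, ℓ_τ) = 0` for every line forces `x = 0`. -/
theorem eq_zero_of_mem_weilSpace_of_forall_Qc_line_eq_zero {c : G} (hc : IsComplexConj c) {Φ₀ : Finset G}
    (hΦ : IsCMType c Φ₀) (M : Multiset (Finset G)) (hM : M ≠ 0) (a : Fin (Multiset.card M) → G → ℂ)
    (ha : ∀ i ρ, ρ ∈ Φ₀ → a i ρ ≠ 0) {x : H M} (hx : x ∈ weilSpace M)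
    (h : ∀ τ, Qc hc hΦ a x (line (Multiset.card M) τ) = 0) : x = 0 :=
  eq_zero_of_mem_span_line_of_forall_Qc_line_eq_zero hc hΦ a ha (Multiset.card_pos.mpr hM) hx h

end HodgeRepro.Night3.GSetModel
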